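import Literature.Computability.QuantumComplexity.ObliviousAmplification
import Literature.Computability.QuantumComplexity.HadamardSandwich
import HarnessLib

/-!
# From entrywise block encodings to oblivious amplitude amplification

Topic `Literature/Computability/QuantumComplexity`; a step in the discharge of
`ajl_jonesApproxProblem_mem_PromiseBQP`. The analytic glue between the Hadamard-sandwich block
encoding (`SandwichBlock.lean`: the entries of `2·W` between clean labels are within `η` of those of a
label-controlled one-qubit unitary `U z` on the target wire `t`, and vanish unless the labels agree
off `t`) and oblivious amplitude amplification (`ObliviousAmplification.oaaOp_implOn`, which wants
`‖2ΠWΠ − VΠ‖ ≤ ε`):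

* `ctrlGate t U` — the matrix acting as the `2 × 2` block `U z` on wire `t`, the block being allowed
  to depend on the label off `t` (`ctrlGate_mem_unitaryGroup`);
* `opNorm_two_smul_proj_sub_ctrlGate_le` — locality off `[t]` plus the entry bound `η` give
  `‖2•(ΠWΠ) − VΠ‖ ≤ 2η` (`HadamardSandwich.l2Norm_mulVec_le_of_local` with one free wire);
* `implOn_oaaOp_of_entries` — hence `ImplOn P (oaaOp Π W Wᴴ) (ctrlGate t U) (9 √(2η))`.

## References

* D. W. Berry, A. M. Childs, R. Cleve, R. Kothari, R. D. Somma, STOC 2014, Lemma 3.1 and proof of Thm. 1.1 (oblivious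
  amplitude amplification) [BerryEtAl2014].
-/

noncomputable section

namespace Literature.Computability.QuantumComplexity

open _root_.Matrix Finset Cryptography
open scoped Matrix.Norms.L2Operator

variable {N : ℕ}

/-! ### Label-controlled one-qubit gates -/

/-- The operator acting on wire `t` as the one-qubit matrix `U z`, the block being read off the
input label `z` (it must not depend on `z t`, see `ctrlGate_mem_unitaryGroup`). [folklore] -/
def ctrlGate (t : Fin N) (U : QReg N → Matrix (QReg 1) (QReg 1) ℂ) : Matrix (QReg N) (QReg N) ℂ :=
  Matrix.of fun x z => if EqOff [t] z x then U z (fun _ => x t) (fun _ => z t) else 0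

/-- Entries of `ctrlGate`. [folklore] -/
theorem ctrlGate_apply (t : Fin N) (U : QReg N → Matrix (QReg 1) (QReg 1) ℂ) (x z : QReg N) :
    ctrlGate t U x z = if EqOff [t] z x then U z (fun _ => x t) (fun _ => z t) else 0 := rfl

/-- Agreement off `[t]` means: equal after overwriting wire `t`. [folklore] -/
theorem eqOff_singleton_iff {t : Fin N} {x z : QReg N} : EqOff [t] z x ↔ z = Function.update x t (z t) := by
  constructor
  · intro h; funext j
    by_cases hj : j = t
    · subst hj; simp
    · rw [Function.update_of_ne hj]; exact h j (by simp [hj])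
  · intro h j hj
    rw [List.mem_singleton] at hj
    rw [h, Function.update_of_ne hj]

/-- A one-qubit label as a function of its bit. [folklore] -/
theorem qreg_one_eq (v : QReg 1) : v = fun _ => v 0 := by
  funext i; rw [Subsingleton.elim i 0]

/-- **`ctrlGate t U` is unitary** when every block is unitary and does not depend on the bit `z t`.
[folklore] -/
theorem ctrlGate_mem_unitaryGroup (t : Fin N) {U : QReg N → Matrix (QReg 1) (QReg 1) ℂ}
    (hU : ∀ z, U z ∈ Matrix.unitaryGroup (QReg 1) ℂ) (hUt : ∀ z b, U (Function.update z t b) = U z) :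
    ctrlGate t U ∈ Matrix.unitaryGroup (QReg N) ℂ := by
  rw [Matrix.mem_unitaryGroup_iff]
  ext x x'
  rw [Matrix.mul_apply, Matrix.one_apply]
  -- only `z ∈ {x[t ↦ b]}` contribute
  have hsupp : ∀ z, z ≠ Function.update x t false → z ≠ Function.update x t true →
      ctrlGate t U x z * (star (ctrlGate t U)) z x' = 0 := by
    intro z h0 h1
    rw [ctrlGate_apply]
    split_ifs with h
    · exfalso
      rw [eqOff_singleton_iff] at h
      cases hz : z t
      · exact h0 (by rw [h, hz])
      · exact h1 (by rw [h, hz])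
    · rw [zero_mul]
  rw [← Finset.sum_subset (Finset.subset_univ {Function.update x t false, Function.update x t true})
    (fun z _ hz => hsupp z (by simpa using fun h => hz (by simp [h])) (by simpa using fun h => hz (by simp [h])))]
  have hne : Function.update x t false ≠ Function.update x t true := fun h => by
    have := congrFun h t; simp at this
  rw [Finset.sum_pair hne]
  simp only [Matrix.star_apply, ctrlGate_apply]
  -- the blocks at `x[t ↦ b]` are those of `x`
  have hUb : ∀ b, U (Function.update x t b) = U x := fun b => hUt x b
  have hE : ∀ b, EqOff [t] (Function.update x t b) x := fun b => eqOff_singleton_iff.2 (by simp)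
  simp only [if_pos (hE _), Function.update_self, hUb]
  by_cases hxx' : EqOff [t] x' x
  · -- same block row/column structure: the `2 × 2` unitarity of `U x`
    have hE' : ∀ b, EqOff [t] (Function.update x t b) x' := fun b => (hE b).trans hxx'.symm
    simp only [if_pos (hE' _)]
    have hu := Matrix.mem_unitaryGroup_iff.1 (hU x)
    have key : ∀ b b' : Bool, (∑ c : Bool, U x (fun _ => b) (fun _ => c) * star (U x (fun _ => b') (fun _ => c))) =
        if b = b' then 1 else 0 := by
      intro b b'
      have e := congrFun (congrFun hu (fun _ => b)) (fun _ => b')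
      rw [Matrix.mul_apply, Matrix.one_apply] at e
      rw [Fintype.sum_bool]
      have hrw : (∑ j : QReg 1, U x (fun _ => b) j * (star (U x)) j (fun _ => b')) =
          U x (fun _ => b) (fun _ => true) * star (U x (fun _ => b') (fun _ => true)) +
            U x (fun _ => b) (fun _ => false) * star (U x (fun _ => b') (fun _ => false)) := by
        rw [← Finset.sum_subset (Finset.subset_univ {(fun _ => true : QReg 1), fun _ => false})
          (fun j _ hj => by exfalso; apply hj; rw [qreg_one_eq j]; cases j 0 <;> simp)]
        rw [Finset.sum_pair (by intro h; have := congrFun h 0; simp at this)]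
        simp [Matrix.star_apply]
      rw [hrw] at e
      rw [e]
      by_cases hbb : b = b'
      · subst hbb; simp
      · rw [if_neg hbb, if_neg]; intro h; exact hbb (by have := congrFun h 0; exact this)
    have := key (x t) (x' t)
    rw [Fintype.sum_bool] at this
    rw [add_comm, this]
    by_cases h : x = x'
    · subst h; simp
    · rw [if_neg h, if_neg]
      intro ht
      apply h
      rw [eqOff_singleton_iff.1 hxx'.symm, ht]; simp
  · have hE' : ∀ b, ¬ EqOff [t] (Function.update x t b) x' := fun b h => hxx' ((h.symm.trans (hE b)).symm.symm)
    simp only [if_neg (hE' _), star_zero, mul_zero, add_zero]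
    rw [if_neg]
    rintro rfl; exact hxx' (eqOff_refl _)

/-! ### The operator-norm bound from entries -/

/-- Entries of `Π M Π'` for coordinate projections. [folklore] -/
theorem projOn_mul_mul_projOn_apply (P Q : Set (QReg N)) [DecidablePred (· ∈ P)] [DecidablePred (· ∈ Q)]
    (M : Matrix (QReg N) (QReg N) ℂ) (x z : QReg N) :
    (projOn P * M * projOn Q) x z = (if x ∈ P then 1 else 0) * M x z * (if z ∈ Q then 1 else 0) := by
  rw [projOn, projOn, Matrix.mul_diagonal, Matrix.diagonal_mul]
  simp [Set.indicator_apply]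

/-- Entries of `M Π`. [folklore] -/
theorem mul_projOn_apply (Q : Set (QReg N)) [DecidablePred (· ∈ Q)] (M : Matrix (QReg N) (QReg N) ℂ) (x z : QReg N) :
    (M * projOn Q) x z = M x z * (if z ∈ Q then 1 else 0) := by
  rw [projOn, Matrix.mul_diagonal]; simp [Set.indicator_apply]

/-- **From entries to the operator norm.** Let membership in `P` not depend on wire `t`; let `W`
vanish between labels of `P` not agreeing off `t`, and let `2·W` be entrywise `η`-close to the blocks
`U z` between labels of `P` agreeing off `t`. Then `‖2•(ΠWΠ) − (ctrlGate t U)Π‖ ≤ 2η`.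
[cite: BerryEtAl2014, §3] -/
theorem opNorm_two_smul_proj_sub_ctrlGate_le {P : Set (QReg N)} {t : Fin N} (hP : ∀ x b, Function.update x t b ∈ P ↔ x ∈ P)
    {W : Matrix (QReg N) (QReg N) ℂ} {U : QReg N → Matrix (QReg 1) (QReg 1) ℂ} {η : ℝ} (hη : 0 ≤ η)
    (hWloc : ∀ x z, x ∈ P → z ∈ P → ¬ EqOff [t] z x → W x z = 0)
    (hWent : ∀ x z, x ∈ P → z ∈ P → EqOff [t] z x → ‖2 * W x z - U z (fun _ => x t) (fun _ => z t)‖ ≤ η) :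
    ‖(2 : ℂ) • (projOn P * W * projOn P) - ctrlGate t U * projOn P‖ ≤ 2 * η := by
  classical
  set K := (2 : ℂ) • (projOn P * W * projOn P) - ctrlGate t U * projOn P with hK
  have hKapply : ∀ x z, K x z = (if x ∈ P then 1 else 0) * (2 * W x z) * (if z ∈ P then 1 else 0) -
      ctrlGate t U x z * (if z ∈ P then 1 else 0) := by
    intro x z
    rw [hK, Matrix.sub_apply, Matrix.smul_apply, projOn_mul_mul_projOn_apply, mul_projOn_apply, smul_eq_mul]; ring
  -- membership in `P` transported along agreement off `t`
  have hPt : ∀ {x z}, EqOff [t] z x → (x ∈ P ↔ z ∈ P) := by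
    intro x z h; rw [eqOff_singleton_iff.1 h]; exact (hP x (z t)).symm
  have hloc : ∀ x z, ¬ EqOff [t] x z → K x z = 0 := by
    intro x z hxz
    have hzx : ¬ EqOff [t] z x := fun h => hxz h.symm
    rw [hKapply, ctrlGate_apply, if_neg hzx, zero_mul, sub_zero]
    by_cases hx : x ∈ P
    · by_cases hz : z ∈ P
      · rw [hWloc x z hx hz hzx]; simp
      · simp [hz]
    · simp [hx]
  have hbd : ∀ x z, ‖K x z‖ ≤ η := by
    intro x z
    by_cases hzx : EqOff [t] z x
    · by_cases hz : z ∈ P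
      · have hx : x ∈ P := (hPt hzx).2 hz
        rw [hKapply, ctrlGate_apply, if_pos hzx, if_pos hx, if_pos hz, one_mul, mul_one, mul_one]
        exact hWent x z hx hz hzx
      · rw [hKapply, if_neg hz]; simp [hη]
    · rw [hloc x z fun h => hzx h.symm, norm_zero]; exact hη
  refine opNorm_le_of_forall_l2Norm_le (by positivity) fun ψ => ?_
  have := l2Norm_mulVec_le_of_local (T := [t]) (List.nodup_singleton t) hη hloc hbd ψ
  simpa [pow_one] using this

/-- **Oblivious amplitude amplification of a block encoding given by its entries.**
[cite: BerryEtAl2014, Lemma 3.1 and proof of Thm. 1.1] -/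
theorem implOn_oaaOp_of_entries {P : Set (QReg N)} {t : Fin N} (hP : ∀ x b, Function.update x t b ∈ P ↔ x ∈ P)
    {W : Matrix (QReg N) (QReg N) ℂ} (hW : W ∈ Matrix.unitaryGroup (QReg N) ℂ)
    {U : QReg N → Matrix (QReg 1) (QReg 1) ℂ} (hU : ∀ z, U z ∈ Matrix.unitaryGroup (QReg 1) ℂ)
    (hUt : ∀ z b, U (Function.update z t b) = U z) {η : ℝ} (hη : 0 ≤ η)
    (hWloc : ∀ x z, x ∈ P → z ∈ P → ¬ EqOff [t] z x → W x z = 0)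
    (hWent : ∀ x z, x ∈ P → z ∈ P → EqOff [t] z x → ‖2 * W x z - U z (fun _ => x t) (fun _ => z t)‖ ≤ η) :
    ImplOn P (oaaOp (projOn P) W Wᴴ) (ctrlGate t U) (9 * Real.sqrt (2 * η)) :=
  oaaOp_implOn P hW (ctrlGate_mem_unitaryGroup t hU hUt) (opNorm_two_smul_proj_sub_ctrlGate_le hP hη hWloc hWent)

end Literature.Computability.QuantumComplexity

end
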